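import Summits.Ventures.CertifiedManyBodySolver.Downfold.EmeryBoxesCuprates
import Summits.Ventures.CertifiedManyBodySolver.Downfold.EmeryFillingRepoint
import Summits.Ventures.CertifiedManyBodySolver.Downfold.ParameterBoxRebase
import HarnessLib

/-!
# Box #19 Hg-1201 3BE companion: the `|t_pp′|` entry re-pointed [0.161, 0.208] → [0.111, 0.208] (RULING R-ml, §OF-RECORD v1.14) — `emeryBoxHg1201v114`,
# and the generic door: seam words do not read `tppP`, so they transfer BOTH WAYS across any `tppP` re-pointing

Venture CertifiedManyBodySolver, cell `pub/hubbard-downfold` (S1 = ROUTER), seat hubbard-downfold-mod-4 (S1/S2 Emery seam); namespace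
`Summit.Ventures.CertifiedManyBodySolver.Downfold`. SOURCE: box #19 `router/BOXES/HgBa2CuO4.md` §OF-RECORD v1.14 (lead g14, 2026-08-28T06:40Z; file sha16
e6e92f5cad3bfba1), RULING R-ml on hubbard-cov-hg1201-lit-1's finding F9: the MACE GWA one-body three-band set of Hirayama et al. 2019 (arXiv:1901.00763, Table:
t_pd 1.184, t_pp′ 0.111, t_pp 0.659) — whose Δ_pd and t_pd already are members of the companion rows — prints |t_pp′| = 0.111 BELOW the typed row
`hg1201Emery_tppP` = [0.161, 0.208] (`EmeryBoxesCuprates`; Weber 2012 0.161 ∪ own w3b 0.208); the lead ADMITS it ⇒ **|t_pp′| [0.161, 0.208] → [0.111, 0.208]**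
(outward; the R-B2-inadmissible GW+LRFB 0.108 not hulled), «ONE typed consequence: re-point `hg1201Emery_tppP` BESIDE, version rule — GO; word-inert». THIS FILE:
`hg1201Emery_tppP_v114`, `emeryBoxHg1201v114 := emeryBoxHg1201.withEntry .tppP hg1201Emery_tppP_v114` (ParameterBoxRebase idiom), accessors, the RE-BASE transfer
`emeryBoxHg1201_refines_v114` (old ⊆ new: words on v1.14 transfer DOWN to the v1.x box), and — because `t_pp′` is NOT one of the six delivered seam coordinates
(t_pd, t_pp, ε_d, ε_p, U_d, U_p) — the two-way door: `emeryLineCoords_update_tppP`, `holdsOn_update_tppP_iff` (ANY Emery box, ANY re-pointing of `tppP`, any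
seam-shape word `p ↦ W (emeryLineCoords εp p)`), specialised as `holdsOn_emeryBoxHg1201v114_iff`: every energy floor / vertex word / Lipschitz transport typed on
`emeryBoxHg1201` holds VERBATIM on `emeryBoxHg1201v114` and conversely. The slices, fl / bare-e images and the [0, 10] GPa P-hull objects that carry a copy of the
old `tppP` entry (`EmeryBoxesHg1201Slices/Fl/BareE/PHull`, `KSlicesA`) are NOT re-issued here: by the same door their seam words are insensitive to it, and each is
re-pointable in one line when a consumer needs the v1.14 `tppP` literally (technique B, which DOES read t_pp′, moves t_B(E) by +3 % at 0.111 — cell file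
router/INFLATION-RULES-3to1-B.md, mod-4 INBOX 2026-08-28T06:31Z). Everything PROVED (0 sorry); SCREENING-GRADE inputs; nothing about the material is certified;
words of record «UND:MIXED+1BH+3BE+EPH» unchanged (t_pp′ is no router input).
-/

namespace Summit.Ventures.CertifiedManyBodySolver.Downfold

open NonemptyInterval Literature.MathematicalPhysics.QuantumLattice

/-! ### Generic: the seam does not read `tppP` -/

/-- The delivered six-vector `(t_pd, t_pp, εp + Δ, εp, U_d, U_p)` does not read the `|t_pp′|` coordinate. [folklore] -/
theorem emeryLineCoords_update_tppP (εp : ℝ) (p : EmeryCoord → ℝ) (v : ℝ) :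
    emeryLineCoords εp (Function.update p .tppP v) = emeryLineCoords εp p := by
  ext i; fin_cases i <;> simp [emeryLineCoords]

/-- **Seam-shape words transfer both ways across ANY re-pointing of the `tppP` entry** (new entry or erased). [folklore] -/
theorem holdsOn_update_tppP_iff (E : EmeryBox) (x : Option Entry) (εp : ℝ) (W : (Fin 6 → ℝ) → Prop) :
    HoldsOn (fun p : EmeryCoord → ℝ => W (emeryLineCoords εp p)) (Function.update E .tppP x) ↔
      HoldsOn (fun p : EmeryCoord → ℝ => W (emeryLineCoords εp p)) E :=
  holdsOn_update_iff_of_ignoresCoord (Box.ignoresCoord_comp (fun p v => emeryLineCoords_update_tppP εp p v) W) E x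

/-! ### Box #19: the v1.14 `|t_pp′|` entry and the re-pointed companion -/

/-- `|t_pp′| ∈ [0.111, 0.208]` (box #19 §OF-RECORD v1.14, RULING R-ml: Hirayama 2019 MACE GWA 0.111 ADMITTED below Weber 2012 0.161; hi = own w3b 0.208; the
ρ_F-inadmissible GW+LRFB 0.108 not hulled); was [0.161, 0.208] (`hg1201Emery_tppP`). [folklore] -/
def hg1201Emery_tppP_v114 : Entry := Entry.ofEnds (111/1000) (26/125) (by norm_num) .screening

/-- **`emeryBoxHg1201v114`** = the 3BE companion of box #19 (`emeryBoxHg1201`, `EmeryBoxesCuprates`) with `tppP` re-issued as `hg1201Emery_tppP_v114`; every other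
entry is the v1.x entry. [folklore] -/
noncomputable def emeryBoxHg1201v114 : EmeryBox := emeryBoxHg1201.withEntry .tppP hg1201Emery_tppP_v114

/-- Accessor: the re-issued `tppP` entry. [folklore] -/
theorem emeryBoxHg1201v114_tppP : emeryBoxHg1201v114 .tppP = some hg1201Emery_tppP_v114 := Box.withEntry_self _ _ _

/-- Accessor: every other entry is `emeryBoxHg1201`'s. [folklore] -/
theorem emeryBoxHg1201v114_of_ne {c : EmeryCoord} (hc : c ≠ .tppP) : emeryBoxHg1201v114 c = emeryBoxHg1201 c :=
  Box.withEntry_of_ne _ _ hc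

/-- **v1.x ⊆ v1.14**: `[0.161, 0.208] ⊆ [0.111, 0.208]` ⇒ the old companion REFINES the re-pointed one; words typed on `emeryBoxHg1201v114` transfer DOWN.
[folklore] -/
theorem emeryBoxHg1201_refines_v114 : emeryBoxHg1201.Refines emeryBoxHg1201v114 :=
  Box.refines_withEntry (e₀ := hg1201Emery_tppP) rfl (fun _ hx => Entry.mem_ofEnds_mono (by norm_num) (by norm_num) hx)

/-- **Seam words are IDENTICAL on the two companions** (the re-pointing touches `tppP` only): a seam-shape word holds on `emeryBoxHg1201v114` iff it holds on
`emeryBoxHg1201` — R-ml's «word-inert» as a theorem. [folklore] -/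
theorem holdsOn_emeryBoxHg1201v114_iff (εp : ℝ) (W : (Fin 6 → ℝ) → Prop) :
    HoldsOn (fun p : EmeryCoord → ℝ => W (emeryLineCoords εp p)) emeryBoxHg1201v114 ↔
      HoldsOn (fun p : EmeryCoord → ℝ => W (emeryLineCoords εp p)) emeryBoxHg1201 :=
  holdsOn_update_tppP_iff emeryBoxHg1201 (some hg1201Emery_tppP_v114) εp W

/-- Pointwise form: a member of the old companion with its `t_pp′` coordinate moved anywhere into [0.111, 0.208] is a member of the re-pointed companion. [folklore] -/
theorem mem_emeryBoxHg1201v114_update {p : EmeryCoord → ℝ} (hp : emeryBoxHg1201.Mem p) {v : ℝ} (hv : hg1201Emery_tppP_v114.Mem v) :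
    emeryBoxHg1201v114.Mem (Function.update p .tppP v) :=
  Box.mem_update_update hp hv

end Summit.Ventures.CertifiedManyBodySolver.Downfold
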